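import Summits.HodgeConjecture.HodgeConjecture.Theorems.SiegelClassifyEqOfAdmissible                 -- ★ P6 p723133 (A-p06 g12): `UHead.classifyingMap_eq_of_isAdmissibleAt` (+ Part3/5/6: (T2), W3, `isAdmissibleAt_iff_markedBy`)
import Literature.AlgebraicGeometry.ModuliOfAbelianVarieties.SiegelAdmissibleClassUniqueTwoReps         -- ★ `units_zmod_eq_of_isAdmissibleAt` (+ B1 `SiegelAdmissibleClassUnique`)
import Literature.AlgebraicGeometry.ModuliOfAbelianVarieties.SiegelAdmissibleExistenceOfPositivity     -- ★ L4 `exists_isAdmissibleAt`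
import Literature.AlgebraicGeometry.ModuliOfAbelianVarieties.SiegelAdmissibleOfIsoTriple               -- ★ (α-inv) `isAdmissibleAt_of_isBaseChangeVia_id'`
import Literature.AlgebraicGeometry.ModuliOfAbelianVarieties.SiegelPrincipalRepSameResidue             -- ★ L2 `inv_mul_mem_principalLevelSubgroup_of_principalRep`
import Literature.AlgebraicGeometry.ModuliOfAbelianVarieties.SiegelPrincipalLevelArithmeticGroup       -- ★ R60-11 `SiegelShimuraSet.mk_jOfSiegel_eq_mk_jOfSiegel_iff`
import Literature.AlgebraicGeometry.ModuliOfAbelianVarieties.SiegelModuliRelation                     -- ★ `rel_iff_exists_smul`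
import Literature.AlgebraicGeometry.AbelianSchemes.PolarizedAbelianSchemeWithLevelBaseChange           -- ★ D-BC∃ `PolarizedAbelianSchemeWithLevel.baseChange`
import Literature.AlgebraicGeometry.AbelianSchemes.PolarizedAbelianSchemeWithLevelBaseChangeUnique     -- ★ L4 (B-p16 g11): `PolarizedAbelianSchemeWithLevel.IsBaseChangeVia.exists_isBaseChangeVia_id`
import HarnessLib

/-!
# (U)-HEAD glue core, part 1 — classifying points of admissible triples: one point per `(c, Γ_δ(N)·Z)`

Cell `hodgecm-mathlib`, (U)-HEAD glue F-δ (census `typers/CENSUS-Uglue.B-p21g13.md`, B-plan2 (g10) road (R1), UHead v0.12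
§4e).  Namespace `Summit.HodgeConjecture.CorCM.HypDel.UHead` (A-p06's P6 file shares it).  KERNEL ONLY: theorems; no definition,
no named fact, no instance, no `sorry`.  P6 = U-c (ii) is consumed BY IMPORT (★ p723133 `classifyingMap_eq_of_isAdmissibleAt`,
A-p06 (g12)) and L4 = pull-back uniqueness for triples BY IMPORT (★ `PolarizedAbelianSchemeWithLevel.IsBaseChangeVia.exists_isBaseChangeVia_id`, B-p16 (g11)).

For a fine moduli scheme `𝓜` and a principal representative `r` of a residue `c`, the classifying point
`classifyingMap P′ ∈ 𝓜(ℂ)` of a triple `P′` over `Spec ℂ` admissible at `(Z, r)`: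
* does not depend on `P′` (P6 = U-c (ii)), nor on the representative `r` of `c` (★ L2 + ★ (T2)), nor on `Z` in its
  `Γ_δ(N)`-orbit (★ R60-11 + ★ (T) `MarkedBy.transport`) — §2;
* DETERMINES admissibility: a triple with the same classifying point is admissible at the same `(Z, r)` (L4 pull-back
  uniqueness + ★ (α-inv)) — §1; hence two such points agree iff `Z ~ Z′ (mod Γ_δ(N))` (★ B1 C-form) — §3;
* the fibre triple `𝓜.univ ×_𝓜 x` at `x ∈ 𝓜(ℂ)` has classifying point `x` (§1), so `x` is such a point for the residue
  `c(x)` of ★ L4 `exists_isAdmissibleAt` and for no other residue (★ `units_zmod_eq_of_isAdmissibleAt`) — §4, the class map.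
-/

set_option autoImplicit false

noncomputable section

open CategoryTheory CategoryTheory.Limits AlgebraicGeometry Matrix Topology
open Literature.AlgebraicGeometry.Motives (SchemeOver ComplexPoints AlgPoints specOver AbelianVariety CartierDivisor)
open Literature.AlgebraicGeometry.AbelianSchemes (PolarizedAbelianSchemeWithLevel AbelianSchemeOver)
open Literature.NumberTheory.Automorphic (siegelUpperHalfSpace)
open Literature.AlgebraicGeometry.ModuliOfAbelianVarieties

namespace Summit.HodgeConjecture.CorCM.HypDel.UHead

open Summit.HodgeConjecture.CorCM.HypDel.M1primeOfFU (MarkedBy isAdmissibleAt_iff_markedBy translateRightT)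
open SiegelModuli (jOfSiegel rel_iff_exists_smul)

variable {g N : ℕ} {δ : Fin g → ℕ}

/-! ### §1. Classifying points: the fibre triple, and admissibility along equal classifying maps -/

/-- **The fibre triple `𝓜.univ ×_𝓜 x` of the universal family at a `ℂ`-point `x` has classifying map `x`**
(★ D-BC∃ `baseChange` + ★ D4 `eq_classifyingMap`). [cite: MumfordFogartyKirwan1994, Ch. 7 §3 Theorem 7.9 (p. 139)] -/
theorem classifyingMap_univ_baseChange (𝓜 : SiegelFineModuliScheme g N δ) [IsLocallyNoetherian (specOver ℚ ℂ).left]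
    (x : AlgPoints 𝓜.M ℂ) :
    𝓜.classifyingMap (specOver ℚ ℂ) (𝓜.univ.baseChange x.left) = x :=
  (𝓜.eq_classifyingMap (specOver ℚ ℂ) (𝓜.univ.baseChange x.left) x
    ⟨_, _, 𝓜.univ.baseChange_isBaseChangeVia x.left⟩).symm

/-- **Equal classifying maps ⇒ equal admissibility** (★ L4 pull-back uniqueness
`IsBaseChangeVia.exists_isBaseChangeVia_id` + ★ (α-inv) `isAdmissibleAt_of_isBaseChangeVia_id'`): both triples are pull-backs of `𝓜.univ` along the common classifying map, hence
related along `𝟙 (Spec ℂ)`. [cite: MumfordFogartyKirwan1994, Ch. 7 §2 Def. 7.2, §3 Thm. 7.9 (pp. 129, 139)]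
[cite: Milne2005ShimuraVarieties, §6 Thm. 6.11 p. 74] -/
theorem isAdmissibleAt_of_classifyingMap_eq (hδ : IsPolarizationType δ) (𝓜 : SiegelFineModuliScheme g N δ)
    [IsLocallyNoetherian (specOver ℚ ℂ).left] {r : gspFinAdelic δ} {Z : Matrix (Fin g) (Fin g) ℂ}
    {hZ : Z ∈ siegelUpperHalfSpace g} {P' P'' : PolarizedAbelianSchemeWithLevel g N δ (specOver ℚ ℂ).left}
    (heq : 𝓜.classifyingMap (specOver ℚ ℂ) P' = 𝓜.classifyingMap (specOver ℚ ℂ) P'')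
    (h : IsAdmissibleAt hδ r Z hZ P') : IsAdmissibleAt hδ r Z hZ P'' := by
  obtain ⟨G₁, Ĝ₁, h₁⟩ := 𝓜.exists_isBaseChangeVia_classifyingMap (specOver ℚ ℂ) P'
  obtain ⟨G₂, Ĝ₂, h₂⟩ := 𝓜.exists_isBaseChangeVia_classifyingMap (specOver ℚ ℂ) P''
  rw [← heq] at h₂
  obtain ⟨H, Ĥ, hBC⟩ := PolarizedAbelianSchemeWithLevel.IsBaseChangeVia.exists_isBaseChangeVia_id h₁ h₂
  exact isAdmissibleAt_of_isBaseChangeVia_id' hδ hBC h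

/-! ### §2. The classifying point does not depend on the representative or on the `Γ_δ(N)`-orbit -/

/-- **Two-representative P6**: `P′` admissible at `(Z, r)`, `P″` admissible at `(Z, r′)` with `r⁻¹ r′ ∈ K_δ(N)`,
`r′ ∈ K_δ(1)` ⇒ equal classifying maps (★ (T2) `MarkedBy.translateRight` with `k := r⁻¹r′`, then ★ P6 `classifyingMap_eq_of_isAdmissibleAt` at `r′`).
[cite: Milne2005ShimuraVarieties, §6 Thm. 6.11 pp. 74–75, §5 Lemma 5.13 p. 57] -/
theorem classifyingMap_eq_of_isAdmissibleAt₂ (hg : 0 < g) (hδ : IsPolarizationType δ) (hN : 3 ≤ N)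
    (𝓜 : SiegelFineModuliScheme g N δ) [IsLocallyNoetherian (specOver ℚ ℂ).left] {r r' : gspFinAdelic δ}
    (hrr' : r⁻¹ * r' ∈ principalLevelSubgroup δ N) (hr' : r' ∈ principalLevelSubgroup δ 1)
    {Z : Matrix (Fin g) (Fin g) ℂ} (hZ : Z ∈ siegelUpperHalfSpace g)
    {P' P'' : PolarizedAbelianSchemeWithLevel g N δ (specOver ℚ ℂ).left}
    (hP' : IsAdmissibleAt hδ r Z hZ P') (hP'' : IsAdmissibleAt hδ r' Z hZ P'') :
    𝓜.classifyingMap (specOver ℚ ℂ) P' = 𝓜.classifyingMap (specOver ℚ ℂ) P'' := by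
  have h₁ : MarkedBy ⟨jOfSiegel δ Z, SiegelComplexRecordSystem.jOfSiegel_mem_C0pm hδ.1 hZ⟩ r' P' := by
    have h := MarkedBy.translateRight hrr' ((isAdmissibleAt_iff_markedBy hδ r Z hZ P').1 hP')
    rwa [mul_inv_cancel_left] at h
  exact classifyingMap_eq_of_isAdmissibleAt g N δ hg hδ hN 𝓜 r' hr' Z hZ P' P''
    ((isAdmissibleAt_iff_markedBy hδ r' Z hZ P').2 h₁) hP''

/-- **`Γ_δ(N)`-move of admissibility** (census L3): if `P′` is admissible at `(Z, r)`, `r ∈ K_δ(1)`, and `Z, Z′` are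
`Γ_δ(N)`-related in the period-map currency of (U2+) (`C ∘ Φ_Z = Φ_{Z′} ∘ M`, `M ∈ Γ_δ(N)`), then `P′` is admissible at
`(Z′, r)`: `[J(Z), r] = [J(Z′), r]` by ★ R60-11 + Lange 3.1.4, then ★ (T) `MarkedBy.transport`.
[cite: Milne2005ShimuraVarieties, Lemma 5.13 p. 57 and §6 Thm. 6.11 p. 74] [cite: Lange2023AbelianVarietiesComplex, §3.1.2 Prop. 3.1.4] -/
theorem isAdmissibleAt_of_rel (hg : 0 < g) (hδ : IsPolarizationType δ) (hN : 3 ≤ N) {r : gspFinAdelic δ}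
    (hr : r ∈ principalLevelSubgroup δ 1) {Z Z' : Matrix (Fin g) (Fin g) ℂ} (hZ : Z ∈ siegelUpperHalfSpace g)
    (hZ' : Z' ∈ siegelUpperHalfSpace g) {P' : PolarizedAbelianSchemeWithLevel g N δ (specOver ℚ ℂ).left}
    (h : IsAdmissibleAt hδ r Z hZ P')
    (hrel : ∃ M ∈ siegelLevelGroup δ N, ∃ C : (Fin g → ℂ) ≃ₗ[ℂ] (Fin g → ℂ),
      ∀ v : Fin g ⊕ Fin g → ℝ, C (siegelPeriodMap δ Z v) = siegelPeriodMap δ Z' (intAct M v)) :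
    IsAdmissibleAt hδ r Z' hZ' P' := by
  have hmk : SiegelShimuraSet.mk δ (principalLevelSubgroup δ N)
        ⟨jOfSiegel δ Z', jOfSiegel_coe_mem_C0pm hδ.1 ⟨Z', hZ'⟩⟩ r =
      SiegelShimuraSet.mk δ (principalLevelSubgroup δ N) ⟨jOfSiegel δ Z, jOfSiegel_coe_mem_C0pm hδ.1 ⟨Z, hZ⟩⟩ r :=
    (SiegelShimuraSet.mk_jOfSiegel_eq_mk_jOfSiegel_iff hδ hg hN hr ⟨Z', hZ'⟩ ⟨Z, hZ⟩).2
      ((rel_iff_exists_smul hδ.1 (siegelLevelGroup_le_symplecticLatticeGroup δ N) hZ hZ').1 hrel)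
  exact (isAdmissibleAt_iff_markedBy hδ r Z' hZ' P').2
    (((isAdmissibleAt_iff_markedBy hδ r Z hZ P').1 h).transport translateRightT hmk.symm)

/-! ### §3. Equal classifying points ⇔ `Γ_δ(N)`-related period points (the (U2+) relation for `f_c`) -/

/-- **The (U2+) relation for classifying points of admissible triples**: for `P′` admissible at `(Z, r)` and `P″`
admissible at `(Z′, r)` (`r ∈ K_δ(1)`, `N ≥ 3`, `0 < g`), `classifyingMap P′ = classifyingMap P″` iff
`C ∘ Φ_Z = Φ_{Z′} ∘ M` for some `M ∈ Γ_δ(N)` and a `ℂ`-linear `C` — (→) L4 + (α-inv) + ★ B1 C-form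
`exists_linearEquiv_siegelPeriodMap_of_isAdmissibleAt`; (←) §2 + P6.
[cite: Milne2005ShimuraVarieties, §6 Thm. 6.11 p. 74, Lemma 5.13 p. 57] [cite: MumfordFogartyKirwan1994, Appendix to Ch. 7 §A (p. 234)] -/
theorem classifyingMap_eq_iff_rel (hg : 0 < g) (hδ : IsPolarizationType δ) (hN : 3 ≤ N)
    (𝓜 : SiegelFineModuliScheme g N δ) [IsLocallyNoetherian (specOver ℚ ℂ).left] {r : gspFinAdelic δ}
    (hr : r ∈ principalLevelSubgroup δ 1) {Z Z' : Matrix (Fin g) (Fin g) ℂ} (hZ : Z ∈ siegelUpperHalfSpace g)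
    (hZ' : Z' ∈ siegelUpperHalfSpace g) {P' P'' : PolarizedAbelianSchemeWithLevel g N δ (specOver ℚ ℂ).left}
    (hP' : IsAdmissibleAt hδ r Z hZ P') (hP'' : IsAdmissibleAt hδ r Z' hZ' P'') :
    𝓜.classifyingMap (specOver ℚ ℂ) P' = 𝓜.classifyingMap (specOver ℚ ℂ) P'' ↔
      ∃ M ∈ siegelLevelGroup δ N, ∃ C : (Fin g → ℂ) ≃ₗ[ℂ] (Fin g → ℂ),
        ∀ v : Fin g ⊕ Fin g → ℝ, C (siegelPeriodMap δ Z v) = siegelPeriodMap δ Z' (intAct M v) := by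
  constructor
  · intro heq
    have h' : IsAdmissibleAt hδ r Z hZ P'' := isAdmissibleAt_of_classifyingMap_eq hδ 𝓜 heq hP'
    exact exists_linearEquiv_siegelPeriodMap_of_isAdmissibleAt hg hδ hN hr hZ hZ' P'' h' hP''
  · intro hrel
    exact classifyingMap_eq_of_isAdmissibleAt g N δ hg hδ hN 𝓜 r hr Z' hZ' P' P''
      (isAdmissibleAt_of_rel hg hδ hN hr hZ hZ' hP' hrel) hP''

/-! ### §4. The class map: the residue of a `ℂ`-point of `𝓜` -/

/-- **Every triple over `Spec ℂ` is admissible at some `(Z, r)` with `r` a principal representative of some residue `c`**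
(★ L4 `exists_isAdmissibleAt`, re-exported with `3 ≤ N`). [cite: Milne2005ShimuraVarieties, §6 Thm. 6.11 p. 74]
[cite: Lange2023AbelianVarietiesComplex, §3.1 Thm. 3.1.2] -/
theorem exists_residue_isAdmissibleAt (hg : 0 < g) (hδ : IsPolarizationType δ) (hN : 3 ≤ N)
    (P' : PolarizedAbelianSchemeWithLevel g N δ (specOver ℚ ℂ).left) :
    ∃ (c : (ZMod N)ˣ) (u : finAdeleQˣ) (r : gspFinAdelic δ),
      (∀ v, Valued.v ((u : finAdeleQ) v) = 1) ∧
      (u : finAdeleQ) - ((c : ZMod N).val : ℕ) ∈ levelIdeal N ∧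
      r ∈ principalLevelSubgroup δ 1 ∧
      IsMultiplier (typeFormOver δ finAdeleQ) (r : GL (Fin g ⊕ Fin g) finAdeleQ) u ∧
      ((r : GL (Fin g ⊕ Fin g) finAdeleQ) : Matrix (Fin g ⊕ Fin g) (Fin g ⊕ Fin g) finAdeleQ) =
        Matrix.fromBlocks 1 0 0 ((u : finAdeleQ) • (1 : Matrix (Fin g) (Fin g) finAdeleQ)) ∧
      ∃ (Z : Matrix (Fin g) (Fin g) ℂ) (hZ : Z ∈ siegelUpperHalfSpace g), IsAdmissibleAt hδ r Z hZ P' :=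
  exists_isAdmissibleAt hδ hg (by omega) P'

/-- **The classifying point of a triple determines its residue**: if `P′` is admissible at `(Z, r)` and `P″` at
`(Z′, r′)` for principal representatives `r, r′` of residues `c, c′`, and `classifyingMap P′ = classifyingMap P″`, then
`c = c′` (L4 + (α-inv) move `P′`'s admissibility to `P″`; ★ `units_zmod_eq_of_isAdmissibleAt`).
[cite: Milne2005ShimuraVarieties, Lemma 5.13 p. 57, §6 Thm. 6.11 p. 74] -/
theorem residue_eq_of_classifyingMap_eq (hg : 0 < g) (hδ : IsPolarizationType δ) (hN : 3 ≤ N)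
    (𝓜 : SiegelFineModuliScheme g N δ) [IsLocallyNoetherian (specOver ℚ ℂ).left]
    {c c' : (ZMod N)ˣ} {u u' : finAdeleQˣ} {r r' : gspFinAdelic δ}
    (huc : (u : finAdeleQ) - ((c : ZMod N).val : ℕ) ∈ levelIdeal N)
    (hr : r ∈ principalLevelSubgroup δ 1) (hru : IsMultiplier (typeFormOver δ finAdeleQ) (r : GL (Fin g ⊕ Fin g) finAdeleQ) u)
    (hu' : ∀ v, Valued.v ((u' : finAdeleQ) v) = 1) (hu'c' : (u' : finAdeleQ) - ((c' : ZMod N).val : ℕ) ∈ levelIdeal N)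
    (hr' : r' ∈ principalLevelSubgroup δ 1)
    (hr'u' : IsMultiplier (typeFormOver δ finAdeleQ) (r' : GL (Fin g ⊕ Fin g) finAdeleQ) u')
    {Z Z' : Matrix (Fin g) (Fin g) ℂ} {hZ : Z ∈ siegelUpperHalfSpace g} {hZ' : Z' ∈ siegelUpperHalfSpace g}
    {P' P'' : PolarizedAbelianSchemeWithLevel g N δ (specOver ℚ ℂ).left}
    (hP' : IsAdmissibleAt hδ r Z hZ P') (hP'' : IsAdmissibleAt hδ r' Z' hZ' P'')
    (heq : 𝓜.classifyingMap (specOver ℚ ℂ) P' = 𝓜.classifyingMap (specOver ℚ ℂ) P'') : c = c' :=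
  units_zmod_eq_of_isAdmissibleAt hg hδ hN huc hr hru hu' hu'c' hr' hr'u' hZ hZ' P''
    (isAdmissibleAt_of_classifyingMap_eq hδ 𝓜 heq hP') hP''

end Summit.HodgeConjecture.CorCM.HypDel.UHead

end
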